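import Summits.QuantumFields.YangMills.Theorems.BalabanLadderROTWardDefs
import HarnessLib

/-!
# Crux `ROT` (stmt-QuantumFields-20042), infinitesimal Ward route (lane B) — I: summation by parts on `(ℤ⁴)ⁿ` and the insertion identity

Helper file (`--supports stmt-QuantumFields-20042`, lane `ym-rot-20042-p2`; vocabulary `Theorems/BalabanLadderROTWardDefs.lean`).
Pure lattice calculus, valid for EVERY lattice weight `W : (ℤ⁴)ⁿ → ℝ` and every cutoff (no limit, no hypothesis on the measure):

* §1 coordinates and scaling (`unitVec_apply`, `scaleSite_add_unitVec`, `norm_contUnitVec`, `mul_norm_le_norm_scaleSite`), box sums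
  and the unit shift (`sum_box_shift_eq`: a box sum of a summand vanishing near the boundary is shift invariant);
* §2 **summation by parts**: `sum_mul_shift_sub_eq` (one slot / direction, a shift-invariant coefficient) and
  `sum_mul_latGen_eq_neg_angularSum` — for every `W` and every `Φ` whose values at the scaled box sites vanish near the boundary,
  `Σ_x W(x) · E_a Φ(x) = − Σ_x (𝓛 W)(x) · Φ(a x)`: the lattice generator on the test-function side IS minus the lattice angular
  momentum on the measure side, exactly, at every cutoff;
* §3 **the insertion identity** `bdiff_torusMoment`: for the centred torus moment function of a species `O`,
  `(∇⁻_{i,μ} W)(x) = E[(O(τ_{xᵢ}U) − O(τ_{xᵢ−e_μ}U)) · ∏_{j≠i} (O(τ_{xⱼ}U) − m)]` — the backward difference in slot `i` is the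
  expectation with the local field replaced by its lattice derivative (linearity of the integral), so `(𝓛 W)(x)` is the insertion of
  the lattice angular derivative `Σᵢ (xᵢ⁰∇⁻_1 − xᵢ¹∇⁻_0) O(xᵢ)` of the field: the rotation-BREAKING insertion of the Ward identity
  (its continuum counterpart vanishes by E1; on the lattice its smallness is the content of the crux, not claimed here).

The comparison `E_a F(x) − (D F)(a x) = O(a²‖x‖)` with the continuum generator and the limit theorem along schemes are in
`…WardTaylor.lean` / `…WardEquiv.lean`.  Refs: K. Symanzik, Nucl. Phys. B 226 (1983) 187; S. Caracciolo, G. Curci, P. Menotti,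
A. Pelissetto, Ann. Phys. 197 (1990) 119 (lattice Ward identities for space-time symmetries, perturbative); tree
`…StubAssemblyLatticeDist.lean` (`latticeDist_apply`, `torusMoment`, `integrable_prod_obs`).  No definition, no fact, no sorry.
-/

set_option autoImplicit false

noncomputable section

open scoped SchwartzMap BigOperators
open MeasureTheory Filter Topology Metric
open Literature.MathematicalPhysics.QuantumFieldTheory Literature.MathematicalPhysics.QuantumLattice
open Literature.MathematicalPhysics.AQFT
open Literature.Probability.LatticeModels (box Site mem_box)
open Summit.QuantumFields.YangMills.Cruxes.OSLegsFromFemtoAndGap.DlrCollarTransfer (MomentBounds MomentBounds6 LowerBounds)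
open Summit.QuantumFields.YangMills.Cruxes.OSLegsAtWeakCouplingC.Sketch (Separated SmallDiam)
open Summit.QuantumFields.YangMills.Cruxes.OSLegsAtWeakCouplingC.Y2Bridge (LatticeRotWard)
open Summit.QuantumFields.YangMills.Theorems.OSLegsFromFemtoAndGap (latticeDist torusMoment latticeDist_apply
  mul_norm_le_norm_smul_siteToE norm_smul_siteToE_sub_le integrable_prod_obs)
open Summit.QuantumFields.YangMills.Theorems.NPointIsotropy.Negative (E4)

namespace Summit.QuantumFields.YangMills.Theorems.ROT.Ward

/-! ## §1 Coordinates, scaling, box sums -/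

section LatticeCalculus

variable {n : ℕ}

/-- Coordinates of the unit lattice vector `e_{i,μ}`. -/
theorem unitVec_apply (i : Fin n) (μ : Fin 4) (j : Fin n) (ν : Fin 4) :
    unitVec i μ j ν = if j = i ∧ ν = μ then 1 else 0 := by
  simp only [unitVec, Pi.single_apply]
  by_cases hj : j = i <;> by_cases hν : ν = μ <;> simp [hj, hν]

/-- The coordinates of `e_{i,μ}` lie in `{0, 1}`. -/
theorem abs_unitVec_apply_le (i : Fin n) (μ : Fin 4) (j : Fin n) (ν : Fin 4) : |unitVec i μ j ν| ≤ 1 := by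
  rw [unitVec_apply]; split_ifs <;> simp

/-- Adding `e_{i,μ}` does not change any other coordinate. -/
theorem add_unitVec_apply_of_ne (x : Fin n → Site 4) (i : Fin n) (μ : Fin 4) (j : Fin n) (ν : Fin 4)
    (h : ¬ (j = i ∧ ν = μ)) : (x + unitVec i μ) j ν = x j ν := by
  simp only [Pi.add_apply, unitVec_apply, if_neg h, add_zero]

/-- Coordinates of the scaled multi-site: `(a·x)ⱼ^ν = a xⱼ^ν`. -/
theorem scaleSite_apply (a : ℝ) (x : Fin n → Site 4) (j : Fin n) (ν : Fin 4) :
    scaleSite a x j ν = a * (x j ν : ℝ) := by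
  simp [scaleSite, siteToE_apply]

/-- Coordinates of the continuum unit vector `ê_{i,μ}`. -/
theorem contUnitVec_apply (i : Fin n) (μ : Fin 4) (j : Fin n) (ν : Fin 4) :
    contUnitVec i μ j ν = if j = i ∧ ν = μ then 1 else 0 := by
  simp only [contUnitVec, Pi.single_apply]
  by_cases hj : j = i <;> by_cases hν : ν = μ <;> simp [hj, hν]

/-- `a·(x + e_{i,μ}) = a·x + a·e_{i,μ}`. -/
theorem scaleSite_add_unitVec (a : ℝ) (x : Fin n → Site 4) (i : Fin n) (μ : Fin 4) :
    scaleSite a (x + unitVec i μ) = scaleSite a x + a • contUnitVec i μ := by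
  funext j
  ext ν
  simp only [scaleSite_apply, Pi.add_apply, Pi.smul_apply, unitVec_apply]
  rw [PiLp.add_apply, PiLp.smul_apply, scaleSite_apply, contUnitVec_apply]
  split_ifs <;> push_cast <;> ring

/-- The continuum unit vectors have norm one. -/
theorem norm_contUnitVec (i : Fin n) (μ : Fin 4) : ‖(contUnitVec i μ : Fin n → E4)‖ = 1 := by
  rw [contUnitVec, Pi.norm_single (G := fun _ : Fin n => E4) (EuclideanSpace.single μ (1 : ℝ))]
  simp

/-- Only slot `i` of `contUnitVec i μ` is non-zero. -/
theorem contUnitVec_apply_of_ne {i j : Fin n} (h : j ≠ i) (μ : Fin 4) : contUnitVec i μ j = 0 := by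
  simp [contUnitVec, h]

/-- `a ‖x‖∞ ≤ ‖a·x‖` (each slot: the sup norm of `ℤ⁴` is dominated by the Euclidean norm). -/
theorem mul_norm_le_norm_scaleSite {a : ℝ} (ha : 0 ≤ a) (x : Fin n → Site 4) : a * ‖x‖ ≤ ‖scaleSite a x‖ := by
  rcases (Nat.eq_zero_or_pos n) with hn | hn
  · subst hn
    rw [norm_of_subsingleton x, mul_zero]
    exact norm_nonneg _
  · haveI : Nonempty (Fin n) := ⟨⟨0, hn⟩⟩
    obtain ⟨j, hj⟩ : ∃ j, ‖x‖ = ‖x j‖ := by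
      obtain ⟨j, -, hj⟩ := Finset.exists_max_image Finset.univ (fun j => ‖x j‖) Finset.univ_nonempty
      exact ⟨j, le_antisymm ((pi_norm_le_iff_of_nonneg (norm_nonneg _)).2 fun k => hj k (Finset.mem_univ _))
        (norm_le_pi_norm x j)⟩
    rw [hj]
    exact (mul_norm_le_norm_smul_siteToE ha (x j)).trans (norm_le_pi_norm (scaleSite a x) j)


/-! ### Box sums and the unit shift -/

/-- Membership in `(box L)ⁿ` through absolute values of the coordinates. -/
theorem mem_piFinset_box_iff {L : ℕ} {x : Fin n → Site 4} :
    x ∈ Fintype.piFinset (fun _ : Fin n => box 4 L) ↔ ∀ j ν, |x j ν| ≤ (L : ℤ) := by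
  simp only [Fintype.mem_piFinset, mem_box, abs_le]

/-- **Shift invariance of box sums for summands vanishing near the boundary**: if `g(x) ≠ 0` forces every
coordinate to satisfy `|x j ν| + 1 ≤ L`, then `Σ_{(box L)ⁿ} g(x + e) = Σ_{(box L)ⁿ} g(x)` for every `e` with coordinates in
`{−1, 0, 1}` (both sums are the sum of `g` over its support). -/
theorem sum_box_shift_eq (L : ℕ) (g : (Fin n → Site 4) → ℂ) (e : Fin n → Site 4) (he : ∀ j ν, |e j ν| ≤ 1)
    (hg : ∀ x, g x ≠ 0 → ∀ j ν, |x j ν| + 1 ≤ (L : ℤ)) :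
    ∑ x ∈ Fintype.piFinset (fun _ : Fin n => box 4 L), g (x + e) =
      ∑ x ∈ Fintype.piFinset (fun _ : Fin n => box 4 L), g x := by
  classical
  set S := Fintype.piFinset (fun _ : Fin n => box 4 L) with hS
  set T := Fintype.piFinset (fun _ : Fin n => box 4 (L + 1)) with hT
  have memT : ∀ x : Fin n → Site 4, x ∈ T ↔ ∀ j ν, |x j ν| ≤ (L : ℤ) + 1 := by
    intro x; rw [hT, mem_piFinset_box_iff]; push_cast; exact Iff.rfl
  have hST : S ⊆ T := by
    intro x hx
    rw [memT]; rw [hS, mem_piFinset_box_iff] at hx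
    exact fun j ν => (hx j ν).trans (by linarith)
  -- step 1: enlarge the summation range of the shifted sum
  have h1 : ∑ x ∈ S, g (x + e) = ∑ x ∈ T, g (x + e) := by
    refine Finset.sum_subset hST fun x _ hxS => ?_
    by_contra hne
    apply hxS
    rw [hS, mem_piFinset_box_iff]
    intro j ν
    have h := hg _ hne j ν
    simp only [Pi.add_apply] at h
    have h2 : |x j ν| ≤ |x j ν + e j ν| + |e j ν| := by
      have := abs_sub (x j ν + e j ν) (e j ν); rwa [add_sub_cancel_right] at this
    linarith [he j ν]
  -- step 2: reindex the shifted sum over the image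
  have h2 : ∑ x ∈ T, g (x + e) = ∑ y ∈ T.image (· + e), g y := by
    rw [Finset.sum_image]
    intro x _ y _ h
    exact add_right_cancel h
  -- step 3: shrink back to `S`
  have h3 : ∑ x ∈ S, g x = ∑ y ∈ T.image (· + e), g y := by
    refine Finset.sum_subset ?_ ?_
    · intro x hx
      rw [Finset.mem_image]
      refine ⟨x - e, ?_, sub_add_cancel x e⟩
      rw [memT]
      rw [hS, mem_piFinset_box_iff] at hx
      intro j ν
      simp only [Pi.sub_apply]
      have := abs_sub (x j ν) (e j ν)
      linarith [hx j ν, he j ν]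
    · intro y _ hyS
      by_contra hne
      apply hyS
      rw [hS, mem_piFinset_box_iff]
      intro j ν
      have h := hg y hne j ν
      linarith [abs_nonneg (y j ν)]
  rw [h1, h2, ← h3]

/-- **Summation by parts in one slot/direction.**  For a lattice weight `W`, a coefficient `c` invariant under the shift
`e_{i,μ}`, and a function `Φ` on `(ℝ⁴)ⁿ` whose values at the scaled box sites vanish near the boundary of the box:
`Σ_x W(x) c(x) (Φ(a(x+e_{i,μ})) − Φ(a x)) = − Σ_x (∇⁻_{i,μ} W)(x) c(x) Φ(a x)`. -/
theorem sum_mul_shift_sub_eq (L : ℕ) (a : ℝ) (W : (Fin n → Site 4) → ℝ) (c : (Fin n → Site 4) → ℂ)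
    (Φ : (Fin n → E4) → ℂ) (i : Fin n) (μ : Fin 4) (hc : ∀ x, c (x + unitVec i μ) = c x)
    (hΦ : ∀ x : Fin n → Site 4, Φ (scaleSite a x) ≠ 0 → ∀ j ν, |x j ν| + 1 ≤ (L : ℤ)) :
    ∑ x ∈ Fintype.piFinset (fun _ : Fin n => box 4 L),
        (W x : ℂ) * c x * (Φ (scaleSite a (x + unitVec i μ)) - Φ (scaleSite a x)) =
      - ∑ x ∈ Fintype.piFinset (fun _ : Fin n => box 4 L), (bdiff i μ W x : ℂ) * c x * Φ (scaleSite a x) := by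
  classical
  set S := Fintype.piFinset (fun _ : Fin n => box 4 L) with hS
  set g : (Fin n → Site 4) → ℂ := fun y => (W (y - unitVec i μ) : ℂ) * c y * Φ (scaleSite a y) with hg
  have hshift : ∑ x ∈ S, (W x : ℂ) * c x * Φ (scaleSite a (x + unitVec i μ)) = ∑ x ∈ S, g x := by
    have h := sum_box_shift_eq L g (unitVec i μ) (abs_unitVec_apply_le i μ) (fun y hy => by
      refine hΦ y fun h0 => hy ?_
      simp only [hg, h0, mul_zero])
    rw [← h]
    refine Finset.sum_congr rfl fun x _ => ?_
    simp only [hg, add_sub_cancel_right, hc x]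
  simp only [mul_sub, Finset.sum_sub_distrib, hshift, hg, bdiff]
  push_cast
  rw [← Finset.sum_sub_distrib, ← Finset.sum_neg_distrib]
  refine Finset.sum_congr rfl fun x _ => ?_
  ring

/-- **Summation by parts, all slots** (the lattice rotation Ward rearrangement at fixed cutoff): for every lattice weight
`W` and every `Φ` whose values at the scaled box sites vanish near the boundary of the box,
`Σ_x W(x) · E_a Φ(x) = − Σ_x (𝓛 W)(x) · Φ(a x)`. -/
theorem sum_mul_latGen_eq_neg_angularSum (L : ℕ) (a : ℝ) (W : (Fin n → Site 4) → ℝ) (Φ : (Fin n → E4) → ℂ)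
    (hΦ : ∀ x : Fin n → Site 4, Φ (scaleSite a x) ≠ 0 → ∀ j ν, |x j ν| + 1 ≤ (L : ℤ)) :
    ∑ x ∈ Fintype.piFinset (fun _ : Fin n => box 4 L), (W x : ℂ) * latGen a Φ x = - angularSum W L a Φ := by
  classical
  set S := Fintype.piFinset (fun _ : Fin n => box 4 L) with hS
  -- coefficient invariances: `x ↦ xᵢ⁰` under `e_{i,1}`, `x ↦ xᵢ¹` under `e_{i,0}`
  have hc0 : ∀ (i : Fin n) (x : Fin n → Site 4), ((((x + unitVec i 1) i 0 : ℤ) : ℝ) : ℂ) = (((x i 0 : ℤ) : ℝ) : ℂ) := by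
    intro i x
    rw [add_unitVec_apply_of_ne x i 1 i 0 (by simp)]
  have hc1 : ∀ (i : Fin n) (x : Fin n → Site 4), ((((x + unitVec i 0) i 1 : ℤ) : ℝ) : ℂ) = (((x i 1 : ℤ) : ℝ) : ℂ) := by
    intro i x
    rw [add_unitVec_apply_of_ne x i 0 i 1 (by simp)]
  have h0 : ∀ i : Fin n, ∑ x ∈ S, (W x : ℂ) * (((x i 0 : ℤ) : ℝ) : ℂ) * (Φ (scaleSite a (x + unitVec i 1)) - Φ (scaleSite a x)) =
      - ∑ x ∈ S, (bdiff i 1 W x : ℂ) * (((x i 0 : ℤ) : ℝ) : ℂ) * Φ (scaleSite a x) :=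
    fun i => sum_mul_shift_sub_eq L a W (fun x => (((x i 0 : ℤ) : ℝ) : ℂ)) Φ i 1 (hc0 i) hΦ
  have h1 : ∀ i : Fin n, ∑ x ∈ S, (W x : ℂ) * (((x i 1 : ℤ) : ℝ) : ℂ) * (Φ (scaleSite a (x + unitVec i 0)) - Φ (scaleSite a x)) =
      - ∑ x ∈ S, (bdiff i 0 W x : ℂ) * (((x i 1 : ℤ) : ℝ) : ℂ) * Φ (scaleSite a x) :=
    fun i => sum_mul_shift_sub_eq L a W (fun x => (((x i 1 : ℤ) : ℝ) : ℂ)) Φ i 0 (hc1 i) hΦ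
  -- expand `latGen`, swap the sums, apply the one-slot identities
  have hL : ∑ x ∈ S, (W x : ℂ) * latGen a Φ x =
      ∑ i, (∑ x ∈ S, (W x : ℂ) * (((x i 0 : ℤ) : ℝ) : ℂ) * (Φ (scaleSite a (x + unitVec i 1)) - Φ (scaleSite a x)) -
        ∑ x ∈ S, (W x : ℂ) * (((x i 1 : ℤ) : ℝ) : ℂ) * (Φ (scaleSite a (x + unitVec i 0)) - Φ (scaleSite a x))) := by
    simp only [latGen, Finset.mul_sum]
    rw [Finset.sum_comm]
    refine Finset.sum_congr rfl fun i _ => ?_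
    rw [← Finset.sum_sub_distrib]
    refine Finset.sum_congr rfl fun x _ => ?_
    ring
  rw [hL, Finset.sum_congr rfl fun i _ => by rw [h0 i, h1 i]]
  -- reassemble `latAngMom`
  rw [angularSum, ← Finset.sum_neg_distrib]
  have hR : ∀ x ∈ S, -(((latAngMom W x : ℝ) : ℂ) * Φ (scaleSite a x)) =
      ∑ i, (-((bdiff i 1 W x : ℂ) * (((x i 0 : ℤ) : ℝ) : ℂ) * Φ (scaleSite a x)) -
        -((bdiff i 0 W x : ℂ) * (((x i 1 : ℤ) : ℝ) : ℂ) * Φ (scaleSite a x))) := by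
    intro x _
    simp only [latAngMom]
    push_cast
    rw [Finset.sum_mul, ← Finset.sum_neg_distrib]
    refine Finset.sum_congr rfl fun i _ => ?_
    ring
  rw [Finset.sum_congr rfl hR, Finset.sum_comm]
  refine Finset.sum_congr rfl fun i _ => ?_
  rw [Finset.sum_sub_distrib, Finset.sum_neg_distrib, Finset.sum_neg_distrib]

end LatticeCalculus

/-! ## The insertion identity: `∇⁻_{i,μ} W` is the moment with the differenced field in slot `i` -/

section Insertion

variable {G : Type} [Group G] [TopologicalSpace G] [IsTopologicalGroup G] [CompactSpace G]
  [MeasurableSpace G] [BorelSpace G]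

/-- **The breaking-field insertion (exact, every cutoff).**  The backward difference of the centred torus moment function in slot
`i`, direction `μ`, is the expectation in which the centred field at `xᵢ` is replaced by the lattice derivative
`O(τ_{xᵢ}U) − O(τ_{xᵢ−e_μ}U)` of the local field (linearity of the integral; the other slots are untouched).  Hence
`(𝓛 W)(x) = Σᵢ E[(xᵢ⁰ ∇⁻_1 − xᵢ¹ ∇⁻_0) O(xᵢ) · ∏_{j≠i} (O(xⱼ) − m)]` is the insertion of the lattice angular derivative of the
field — the quantity whose continuum counterpart vanishes by E1 and whose smallness on the lattice is the content of the crux. -/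
theorem bdiff_torusMoment (r : LatticeRep G) (β : ℝ) (L : ℕ) (s : YMSpecies G) (m : ℝ) {n : ℕ} (i : Fin n) (μ : Fin 4)
    (x : Fin n → Site 4) :
    bdiff i μ (torusMoment r.ρ β L s.F m) x =
      ∫ U, (s.F (configShift (-(x i)) (torusLift (2 * L + 1) U)) -
          s.F (configShift (-(x i - Pi.single μ 1)) (torusLift (2 * L + 1) U))) *
        ∏ j ∈ Finset.univ.erase i, (s.F (configShift (-(x j)) (torusLift (2 * L + 1) U)) - m)
        ∂(wilsonMeasure (d := 4) (L := 2 * L + 1) r.ρ β) := by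
  unfold bdiff torusMoment
  rw [← integral_sub (integrable_prod_obs r β L s m x) (integrable_prod_obs r β L s m (x - unitVec i μ))]
  refine integral_congr_ae (Eventually.of_forall fun U => ?_)
  have hne : ∀ j ∈ Finset.univ.erase i, (x - unitVec i μ) j = x j := fun j hj => by
    rw [Pi.sub_apply, unitVec, Pi.single_apply, if_neg (Finset.ne_of_mem_erase hj), sub_zero]
  have hi : (x - unitVec i μ) i = x i - Pi.single μ 1 := by simp [unitVec]
  simp only
  rw [← Finset.mul_prod_erase Finset.univ _ (Finset.mem_univ i),
    ← Finset.mul_prod_erase Finset.univ (fun j => s.F (configShift (-(x - unitVec i μ) j) (torusLift (2 * L + 1) U)) - m)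
      (Finset.mem_univ i)]
  have hP : ∏ j ∈ Finset.univ.erase i, (s.F (configShift (-(x - unitVec i μ) j) (torusLift (2 * L + 1) U)) - m) =
      ∏ j ∈ Finset.univ.erase i, (s.F (configShift (-(x j)) (torusLift (2 * L + 1) U)) - m) :=
    Finset.prod_congr rfl fun j hj => by rw [hne j hj]
  rw [hP, hi]
  ring

end Insertion

end Summit.QuantumFields.YangMills.Theorems.ROT.Ward

end
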